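import Summits.BirchSwinnertonDyer.BirchSwinnertonDyer.Theses.AdditiveBranchIMC
import Summits.BirchSwinnertonDyer.BirchSwinnertonDyer.Theorems.AdditiveBranchIMCInputs
import HarnessLib

/-!
# Route `AdditiveBranchIMC` (rung K1, cell `bsd-addord`): the support item `X3CaseOneRankZero` PROVED

Item `stmt-BirchSwinnertonDyer-19363` of route `route-BirchSwinnertonDyer-AdditiveBranchIMC`
(`Theses/AdditiveBranchIMC.lean`, support, rank 9, «provable-now»): from the route's two fact
conjunctions `PrintedFacts` (8 named Literature facts, verbatim in print) and `ReadingFacts`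
(5 named Literature facts, readings at an additive potentially ordinary prime), every `E/ℚ` of
analytic rank `0` at an odd additive (G)-ordinary prime `p` of semistability index `2` whose isogeny
class has a Case-1 member (`HasCaseOneMember W p`) satisfies the lower half
`MissingLowerBoundAt W p` (`ord_p #Ш(E)_an ≤ ord_p #Ш(E)`).  The proof is the landed bridge
`AdditiveBranchIMCInputs.x3CaseOneRankZero_of_facts` (p408203) after destructuring the two
conjunctions; nothing new is asserted and no fact is assumed beyond the item's own hypotheses.

References: Greenberg–Vatsal, Invent. Math. 142 (2000) Thm. (3.12) [GreenbergVatsal2000];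
Delbourgo, Compositio Math. 113 (1998) Prop. 4 [Delbourgo1998]; Milne, Arithmetic Duality Theorems
(2006) Thm. I.7.3 [MilneADT2006].
-/

set_option autoImplicit false
set_option linter.dupNamespace false

namespace Summit.BirchSwinnertonDyer.BirchSwinnertonDyer.Theorems

/-- **Item `X3CaseOneRankZero` of route `AdditiveBranchIMC` holds**: the Case-1 rank-0 rows of cell
(G-ord, `e = 2`) get `MissingLowerBoundAt` from the printed and the reading facts, by the bridge
`AdditiveBranchIMCInputs.x3CaseOneRankZero_of_facts`. [cite: GreenbergVatsal2000, Thm 3.12]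
[cite: Delbourgo1998, Prop 4] [cite: MilneADT2006, Thm I.7.3] -/
theorem additiveBranchIMC_x3CaseOneRankZero_proof :
    Summit.BirchSwinnertonDyer.BirchSwinnertonDyer.Theses.AdditiveBranchIMC.X3CaseOneRankZero := by
  unfold Summit.BirchSwinnertonDyer.BirchSwinnertonDyer.Theses.AdditiveBranchIMC.X3CaseOneRankZero
    Summit.BirchSwinnertonDyer.BirchSwinnertonDyer.Theses.AdditiveBranchIMC.PrintedFacts
    Summit.BirchSwinnertonDyer.BirchSwinnertonDyer.Theses.AdditiveBranchIMC.ReadingFacts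
  rintro ⟨h23, h414, hGrK, hDel98, hGZK, hmod, hmodD, hCassels⟩ ⟨hW16, hGV, hLiftF, hLiftE, hDelG⟩
  exact AdditiveBranchIMCInputs.x3CaseOneRankZero_of_facts h23 h414 hGrK hDel98 hGZK hmod hmodD
    hCassels hW16 hGV hLiftF hLiftE hDelG

end Summit.BirchSwinnertonDyer.BirchSwinnertonDyer.Theorems
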